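import Mathlib
import Summits.RiemannHypothesis.RiemannHypothesis.Theorems.WeilFormatCHilbertPartBound
import HarnessLib

/-!
# Format C: the odd-sector Hilbert part with the weights `w_n = 1/n` — a logarithmic diagonal majorant

Route context as in `WeilFormatCHilbertPartBound.lean` (cell memo
`run/shared/lean/pub/rh-explicit/rh-explicit-weil-10/FORMATC-DESIGN.md` §4.3 / §8.7; supporting
stmt-RiemannHypothesis-0098).  That file absorbs the odd-sector Hilbert matrix `(1/(n+m))_{n,m>M₁}` into the diagonal
with the Schur weights `m^{−1/2}`, giving the majorant `2(π/2 − arctan √(M₁/n))` — `π/2` right above the cut `n = M₁+1`.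
With the weights `w_m = 1/m` instead one gets `n·Σ_{m>M₁} 1/(m(n+m)) ≤ log((n+M₁)/M₁)` — only `log 2 ≈ 0.69` at the
cut, growing like `log n` (which the archimedean diagonal `Re ψ(¼+iω_n/2) ~ log n` absorbs with a factor 2 to spare).
At a = 1 this is what lets the odd block close near the even block size (FORMATC-DESIGN §8.7).

* `WeilFormatC.integral_inv_mul_add` — `∫_A^B dt/(t(n+t)) = (1/n)(log(B/(n+B)) − log(A/(n+A)))` (`0 < n`, `0 < A ≤ B`);
* `WeilFormatC.sum_inv_mul_add_le_log` — `Σ_{m=M₁+1}^{N} 1/(m(n+m)) ≤ (1/n)·log((n+M₁)/M₁)` (`0 < n`, `1 ≤ M₁ ≤ N`);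
* `WeilFormatC.abs_hilbertPart_le_log` — for `y` on the modes `M₁ < n ≤ N`:
  **`|Σ_n Σ_m y_n y_m/(n+m)| ≤ Σ_n log((n+M₁)/M₁) · y_n²`.**

Elementary; standard axioms only.
-/

-- `Summit.RiemannHypothesis.RiemannHypothesis.…` is the layout-mandated namespace (summit = problem name).
set_option linter.dupNamespace false

noncomputable section

open Finset MeasureTheory Set intervalIntegral
open scoped Real

namespace Summit.RiemannHypothesis.RiemannHypothesis.Theorems.WeilFormatC

/-- The primitive: for `0 < n`, `0 < t`, `d/dt [(1/n)(log t − log(n+t))] = 1/(t(n+t))`. -/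
theorem hasDerivAt_log_sub_log_div {n t : ℝ} (hn : 0 < n) (ht : 0 < t) :
    HasDerivAt (fun t : ℝ ↦ (1 / n) * (Real.log t - Real.log (n + t))) (1 / (t * (n + t))) t := by
  have hnt : 0 < n + t := by linarith
  have h1 : HasDerivAt (fun t : ℝ ↦ Real.log t) (1 / t) t := by
    simpa using (hasDerivAt_id t).log ht.ne'
  have h2 : HasDerivAt (fun t : ℝ ↦ Real.log (n + t)) (1 / (n + t)) t := by
    simpa using ((hasDerivAt_id t).const_add n).log hnt.ne'
  have h3 := (h1.sub h2).const_mul (1 / n)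
  refine h3.congr_deriv ?_
  field_simp
  ring

/-- `∫_A^B dt/(t(n+t)) = (1/n)(log B − log(n+B)) − (1/n)(log A − log(n+A))` for `0 < n`, `0 < A ≤ B`. -/
theorem integral_inv_mul_add {n A B : ℝ} (hn : 0 < n) (hA : 0 < A) (hAB : A ≤ B) :
    ∫ t in A..B, 1 / (t * (n + t))
      = (1 / n) * (Real.log B - Real.log (n + B)) - (1 / n) * (Real.log A - Real.log (n + A)) := by
  have hderiv : ∀ t ∈ uIcc A B,
      HasDerivAt (fun t : ℝ ↦ (1 / n) * (Real.log t - Real.log (n + t))) (1 / (t * (n + t))) t := by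
    intro t ht
    rw [uIcc_of_le hAB] at ht
    exact hasDerivAt_log_sub_log_div hn (lt_of_lt_of_le hA ht.1)
  have hcont : ContinuousOn (fun t : ℝ ↦ 1 / (t * (n + t))) (uIcc A B) := by
    rw [uIcc_of_le hAB]
    refine ContinuousOn.div continuousOn_const (by fun_prop) fun t ht ↦ ?_
    have : 0 < t := lt_of_lt_of_le hA ht.1
    positivity
  rw [integral_eq_sub_of_hasDerivAt hderiv hcont.intervalIntegrable]

/-- **`Σ_{m=M₁+1}^{N} 1/(m(n+m)) ≤ (1/n)·log((n+M₁)/M₁)`** for `0 < n`, `1 ≤ M₁ ≤ N`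
(antitone comparison with `∫_{M₁}^{N} dt/(t(n+t))`, then `log N − log(n+N) ≤ 0`). -/
theorem sum_inv_mul_add_le_log {n : ℝ} (hn : 0 < n) {M₁ N : ℕ} (hM : 1 ≤ M₁) (hMN : M₁ ≤ N) :
    ∑ m ∈ Finset.Ioc M₁ N, 1 / ((m : ℝ) * (n + m)) ≤ (1 / n) * Real.log ((n + M₁) / M₁) := by
  set f : ℝ → ℝ := fun t ↦ 1 / (t * (n + t)) with hf
  have hM0 : (0 : ℝ) < M₁ := by exact_mod_cast hM
  have hanti : AntitoneOn f (Icc (M₁ : ℝ) N) := by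
    intro u hu v hv huv
    simp only [hf]
    have hu0 : 0 < u := lt_of_lt_of_le hM0 hu.1
    have hv0 : 0 < v := lt_of_lt_of_le hM0 hv.1
    apply one_div_le_one_div_of_le (by positivity)
    have : n + u ≤ n + v := by linarith
    exact mul_le_mul huv this (by positivity) hv0.le
  have hcmp := AntitoneOn.sum_le_integral_Ico hMN hanti
  have hre : ∑ m ∈ Finset.Ioc M₁ N, f m = ∑ i ∈ Finset.Ico M₁ N, f ((i + 1 : ℕ) : ℝ) := by
    have : Finset.Ioc M₁ N = Finset.image (fun i ↦ i + 1) (Finset.Ico M₁ N) := by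
      ext m
      simp only [Finset.mem_Ioc, Finset.mem_image, Finset.mem_Ico]
      constructor
      · intro h; exact ⟨m - 1, by omega, by omega⟩
      · rintro ⟨i, hi, rfl⟩; omega
    rw [this, Finset.sum_image (fun i _ j _ h ↦ by simpa using h)]
  have hsum : ∑ m ∈ Finset.Ioc M₁ N, 1 / ((m : ℝ) * (n + m)) = ∑ m ∈ Finset.Ioc M₁ N, f m := by
    simp [hf]
  rw [hsum, hre]
  refine hcmp.trans ?_
  simp only [hf]
  rw [integral_inv_mul_add hn hM0 (by exact_mod_cast hMN)]
  have hN0 : (0 : ℝ) < N := lt_of_lt_of_le hM0 (by exact_mod_cast hMN)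
  have hlogN : Real.log (N : ℝ) - Real.log (n + N) ≤ 0 := by
    have := Real.log_le_log hN0 (by linarith : (N : ℝ) ≤ n + N)
    linarith
  have hdiv : Real.log ((n + M₁) / M₁) = Real.log (n + M₁) - Real.log M₁ :=
    Real.log_div (by positivity) hM0.ne'
  rw [hdiv]
  have h1n : 0 < 1 / n := by positivity
  nlinarith [mul_nonpos_iff.mpr (Or.inl ⟨h1n.le, hlogN⟩)]

/-- **The odd-sector Hilbert part with logarithmic weights.**  For every `1 ≤ M₁ ≤ N` and every real `y` on the
modes `M₁ < n ≤ N`:  `|Σ_n Σ_m y_n y_m /(n+m)| ≤ Σ_n log((n+M₁)/M₁) · y_n²`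
(weighted Schur test `WeilFormatC.abs_quadForm_le_diag_of_schurWeights` with `w_n = 1/n` and `sum_inv_mul_add_le_log`). -/
theorem abs_hilbertPart_le_log {M₁ N : ℕ} (hM : 1 ≤ M₁) (hMN : M₁ ≤ N) (y : ℕ → ℝ) :
    |∑ n ∈ Finset.Ioc M₁ N, ∑ m ∈ Finset.Ioc M₁ N, y n * (1 / ((n : ℝ) + m)) * y m|
      ≤ ∑ n ∈ Finset.Ioc M₁ N, Real.log (((n : ℝ) + M₁) / M₁) * y n ^ 2 := by
  set s := Finset.Ioc M₁ N with hs
  have hpos : ∀ i ∈ s, (0 : ℝ) < i := fun i hi ↦ by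
    have : M₁ < i := (Finset.mem_Ioc.mp hi).1
    exact_mod_cast (lt_of_lt_of_le (Nat.lt_of_lt_of_le Nat.zero_lt_one hM) this.le)
  have h := abs_quadForm_le_diag_of_schurWeights s (fun i j ↦ 1 / ((i : ℝ) + j)) (fun i j ↦ 1 / ((i : ℝ) + j))
    (fun i ↦ 1 / (i : ℝ)) y (fun i _ j _ ↦ ?_) (fun i _ j _ ↦ by rw [add_comm]) (fun i hi ↦ by
      have := hpos i hi; positivity)
  · refine h.trans (Finset.sum_le_sum fun i hi ↦ ?_)
    have hi0 := hpos i hi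
    apply mul_le_mul_of_nonneg_right _ (sq_nonneg _)
    have hk : ∑ j ∈ s, 1 / ((i : ℝ) + j) * (1 / (j : ℝ)) = ∑ j ∈ s, 1 / ((j : ℝ) * (i + j)) := by
      refine Finset.sum_congr rfl fun j _ ↦ ?_
      rw [one_div_mul_one_div, mul_comm]
    rw [hk, one_div, inv_inv]
    have hb := sum_inv_mul_add_le_log hi0 hM hMN
    calc (i : ℝ) * ∑ j ∈ s, 1 / ((j : ℝ) * (i + j)) ≤ (i : ℝ) * ((1 / i) * Real.log ((i + M₁) / M₁)) :=
          mul_le_mul_of_nonneg_left hb hi0.le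
      _ = Real.log ((i + M₁) / M₁) := by field_simp
  · have : (0 : ℝ) ≤ 1 / ((i : ℝ) + j) := by positivity
    rw [abs_of_nonneg this]

end Summit.RiemannHypothesis.RiemannHypothesis.Theorems.WeilFormatC
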